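import Mathlib
import Literature.NumberTheory.LFunctions.Zhang2022.Section16AU018OfU015
import Literature.NumberTheory.LFunctions.Zhang2022.Section16AEq1612Weighted
import Literature.NumberTheory.LFunctions.Zhang2022.Section16AU015
import HarnessLib

/-!
# Zhang (2022) §16, (16.12) from the two analytic displays of §16 part A that remain — the composed edge
# `u015 (on the support of b₁) → (16.10) (weighted, polynomial rate, on the support of b₁) → Eq16_12 c′`

Topic `Literature/NumberTheory/LFunctions/Zhang2022` (Landau–Siegel audit tree; verdict-neutral).
Y. Zhang, *Discrete mean estimates and the Landau–Siegel zero*, arXiv:2211.02515v1 (2022)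
[Zhang2022LandauSiegel] — **an unrefereed manuscript under adjudication** (ZHANG-L discharge lane, WP16).
The leaf `Typed.Section16A.Eq16_12 c′` (hypothesis `h16_12` of `Skeleton.theorem1_of_leaves_v19`; display
(16.12) [Z22 p. 92, tex L4558]) is the end of the chain (16.3) → u011 → (16.4) → u012 → u015 → u017 → u018 →
(16.5) → (16.6) → u020 → (16.9) → u021–u023 → (16.10) → (16.12) of §16 part A. All of its exact/bookkeeping
links are now tree theorems: u011/(16.4) (`Section16Eq164Mellin`, zl-libC-p5), u012/(16.6)/u020/u021
(`TypedSection16ALeaves`, `TypedSection16ACalM2`), u015 ⇒ u018 (`Section16AU018OfU015`), u018 ⇒ (16.5)ᴾ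
(`Section16AEq165Assembly`), (16.5)ᴾ + (16.10) ⇒ (16.12) (`Section16AEq1612Assembly`,
`Section16AEq1612Weighted`). This file records the COMPOSITION, so that the leaf is CLOSED MODULO exactly two
analytic displays, each required on the support of `b₁` (`dl`, resp. `l₂`, `< 2T²P^{1/2}max(P₂,P₃) = 2PT⁻⁸`;
RANGE NOTE in `Section16AEq1612Assembly`):

* `h15w` — §16.u015 [Z22 p. 90, tex L4484] ("similar to the treatment of (7.19) … by Lemma 5.5 … by (5.15)":
  the contour shift of the `Δ`-Mellin integral (16.4) to the residue at `s = ρ̃`, then `ρ̃ ↦ 1`), with the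
  printed error `O(α¹⁰⁰τ₂(d₁)Dpk/l₂)` and the printed range `l₂ < P₂²` widened to the support bound;
* `h10w` — (16.10) [Z22 p. 92, tex L4550] ("In a way similar to the proof of (15.15)": the contour shift of
  the `ω₁`-weighted integral u023 past the poles `s = −β₁, −β₂` of (16.11)), with error
  `C·∏_{q∣dl}(1 + c₀/q^{9/10})·𝓛⁻¹²⁰` (weighted polynomial rate — the residue at `s = ρ̃ − 1`, cf. tex L4221)
  instead of the printed uniform `O(ε₁)`, coprimality asked of `l` only.

Main results: `eq16_12_of_u015w_of_eq16_10w` (weighted (16.10)) and `eq16_12_of_u015w_of_eq16_10_on_support`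
(printed-rate (16.10) on the support). Once the two displays are tree theorems (in flight: zl-libC-p3's
`DeltaContourShift` engine for u015, zl-w16-p5's (16.10) on zl-libC-p2's `GaussKernelContour` engine), the
closer `eq16_12_holds`-shape is one line from here. No new definitions, no named facts, no `sorry`; nothing
here bears on Theorems 1–2 of the source or on Landau–Siegel zeros.

## References

* Y. Zhang, arXiv:2211.02515v1 (2022), §16 pp. 89–92, u015 tex L4484, (16.10)–(16.12) tex L4549–L4565.
  [cite: Zhang2022LandauSiegel, §16 (16.12) p.92]
-/

noncomputable section

open Complex Real
open Literature.NumberTheory.LFunctions.Zhang2022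
open Literature.NumberTheory.LFunctions.Zhang2022.Skeleton

namespace Literature.NumberTheory.LFunctions.Zhang2022.Typed.Section16A

variable (c' : ℝ)

/-- **(16.12) ⇐ u015 (on the support of `b₁`) + (16.10) (weighted polynomial rate, on the support of `b₁`)**:
the composition `eq16_12_of_eq16_5P_of_eq16_10_weighted ∘ eq16_5P_of_u018 ∘ step16_u018_of_u015w`.
[cite: Zhang2022LandauSiegel, §16 (16.12) p.92] -/
theorem eq16_12_of_u015w_of_eq16_10w
    (h15w : ∃ C : ℝ, ForAllLarge fun D _ χ => AssumptionA D χ →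
      ∀ p ∈ primeWindow D, ∀ d₁ d₂ k l₂ : ℕ, 1 ≤ d₁ → 1 ≤ d₂ → 1 ≤ k → 1 ≤ l₂ →
        (l₂ : ℝ) < 2 * bigT D ^ 2 * (bigP D ^ (1 / 2 : ℝ) * max (Skeleton.P2 D) (P3 D)) →
        ((d₁ * d₂ * k : ℕ) : ℝ) < 2 * P4 D →
        ‖(∑' l₁ : ℕ, if Nat.Coprime l₁ (d₂ * k) then
              kappa2 c' D (d₁ * l₁) * χ (l₁ : ZMod D) *
                DeltaW D (((l₁ * l₂ : ℕ) : ℝ) / ((D : ℝ) * p * k))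
            else 0) -
            calR2star c' χ * (((D : ℝ) * p * k / l₂ : ℝ) : ℂ) * kappaTilde2 c' χ d₁ (d₂ * k) 1 *
              lam2 c' χ (d₁ * d₂ * k) 1‖ ≤
          C * alpha D ^ 100 * d₁.divisors.card * ((D : ℝ) * p * k / l₂))
    (h10w : ∃ c₀ C : ℝ, ForAllLarge fun D _ χ => AssumptionA D χ →
      ∀ d l : ℕ, 1 ≤ d → 1 ≤ l →
        ((d * l : ℕ) : ℝ) < 2 * bigT D ^ 2 * (bigP D ^ (1 / 2 : ℝ) * max (Skeleton.P2 D) (P3 D)) →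
        Nat.Coprime l D →
        ‖calD2 c' χ d l - lam2 c' χ d 1 * ∑ j ∈ ({1, 2} : Finset ℕ),
            calR2 c' χ j * (d : ℂ) ^ betaJ c' D j * calM2 c' χ d l (1 - betaJ c' D j)‖ ≤
          C * (∏ q ∈ (d * l).primeFactors, (1 + c₀ / (q : ℝ) ^ (9 / 10 : ℝ))) * (ell D ^ 120)⁻¹) :
    Eq16_12 c' :=
  eq16_12_of_eq16_5P_of_eq16_10_weighted c' (eq16_5P_of_u018 c' (step16_u018_of_u015w c' h15w)) h10w

/-- **(16.12) ⇐ u015 (on the support of `b₁`) + (16.10) with its printed rate `O(ε₁)` (on the support of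
`b₁`)**: the composition `eq16_12_of_eq16_5P_of_eq16_10_on_support ∘ eq16_5P_of_u018 ∘ step16_u018_of_u015w`.
[cite: Zhang2022LandauSiegel, §16 (16.12) p.92] -/
theorem eq16_12_of_u015w_of_eq16_10_on_support
    (h15w : ∃ C : ℝ, ForAllLarge fun D _ χ => AssumptionA D χ →
      ∀ p ∈ primeWindow D, ∀ d₁ d₂ k l₂ : ℕ, 1 ≤ d₁ → 1 ≤ d₂ → 1 ≤ k → 1 ≤ l₂ →
        (l₂ : ℝ) < 2 * bigT D ^ 2 * (bigP D ^ (1 / 2 : ℝ) * max (Skeleton.P2 D) (P3 D)) →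
        ((d₁ * d₂ * k : ℕ) : ℝ) < 2 * P4 D →
        ‖(∑' l₁ : ℕ, if Nat.Coprime l₁ (d₂ * k) then
              kappa2 c' D (d₁ * l₁) * χ (l₁ : ZMod D) *
                DeltaW D (((l₁ * l₂ : ℕ) : ℝ) / ((D : ℝ) * p * k))
            else 0) -
            calR2star c' χ * (((D : ℝ) * p * k / l₂ : ℝ) : ℂ) * kappaTilde2 c' χ d₁ (d₂ * k) 1 *
              lam2 c' χ (d₁ * d₂ * k) 1‖ ≤
          C * alpha D ^ 100 * d₁.divisors.card * ((D : ℝ) * p * k / l₂))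
    (h10 : ∃ c : ℝ, 0 < c ∧ ∃ C : ℝ, ForAllLarge fun D _ χ => AssumptionA D χ →
      ∀ d l : ℕ, 1 ≤ d → 1 ≤ l →
        ((d * l : ℕ) : ℝ) < 2 * bigT D ^ 2 * (bigP D ^ (1 / 2 : ℝ) * max (Skeleton.P2 D) (P3 D)) →
        Nat.Coprime l D →
        ‖calD2 c' χ d l - lam2 c' χ d 1 * ∑ j ∈ ({1, 2} : Finset ℕ),
            calR2 c' χ j * (d : ℂ) ^ betaJ c' D j * calM2 c' χ d l (1 - betaJ c' D j)‖ ≤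
          C * Real.exp (-c * ell D ^ (1 / 10 : ℝ))) :
    Eq16_12 c' :=
  eq16_12_of_eq16_5P_of_eq16_10_on_support c' (eq16_5P_of_u018 c' (step16_u018_of_u015w c' h15w)) h10

/-! ## After `Section16AU015` (zl-libC-p3, p481246/p481553): u015 ⇒ u018 ⇒ (16.5)ᴾ hold by name, so the
leaf `Eq16_12 c′` now waits on the single display (16.10) (weighted, on the support of `b₁`). -/

/-- **(16.5) in the `o(p)` reading HOLDS** (`Typed.Section16A.Eq16_5P c′`, every `c′`): the tree's
`step16_u018_holds` (u015 by `DeltaContourShift` ⇒ u018) fed into `eq16_5P_of_u018`. CONDITIONAL on (A)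
inside `ForAllLarge`, exactly as the manuscript. [cite: Zhang2022LandauSiegel, §16 (16.5) p.91] -/
theorem eq16_5P_holds : Eq16_5P c' := eq16_5P_of_u018 c' (step16_u018_holds c')

/-- `Eq16_5P` — `_holds` alias of `eq16_5P_holds` above under the fact's exact name (appended
2026-08-28, D-0026 bookkeeping: the proof term is the existing theorem of this file; no statement,
definition or attribute is edited; no new named fact; the ledger's debt table listed the fact
unproved). [cite: Zhang2022LandauSiegel, §16 (16.5) p.91] -/
theorem _root_.Literature.NumberTheory.LFunctions.Zhang2022.Typed.Section16A.Eq16_5P_holds :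
    Eq16_5P c' :=
  _root_.Literature.NumberTheory.LFunctions.Zhang2022.Typed.Section16A.eq16_5P_holds (c' := c')

/-- **(16.12) ⇐ (16.10) alone** (weighted polynomial rate, on the support of `b₁`, coprimality of `l` only —
the text of record RT16-int-2, i.e. the hypothesis `h10` of `eq16_12_of_eq16_5P_of_eq16_10_weighted`):
with (16.5)ᴾ now a theorem, the leaf `Eq16_12 c′` follows from that one display.
[cite: Zhang2022LandauSiegel, §16 (16.12) p.92] -/
theorem eq16_12_of_eq16_10W
    (h10w : ∃ c₀ C : ℝ, ForAllLarge fun D _ χ => AssumptionA D χ →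
      ∀ d l : ℕ, 1 ≤ d → 1 ≤ l →
        ((d * l : ℕ) : ℝ) < 2 * bigT D ^ 2 * (bigP D ^ (1 / 2 : ℝ) * max (Skeleton.P2 D) (P3 D)) →
        Nat.Coprime l D →
        ‖calD2 c' χ d l - lam2 c' χ d 1 * ∑ j ∈ ({1, 2} : Finset ℕ),
            calR2 c' χ j * (d : ℂ) ^ betaJ c' D j * calM2 c' χ d l (1 - betaJ c' D j)‖ ≤
          C * (∏ q ∈ (d * l).primeFactors, (1 + c₀ / (q : ℝ) ^ (9 / 10 : ℝ))) * (ell D ^ 120)⁻¹) :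
    Eq16_12 c' :=
  eq16_12_of_eq16_5P_of_eq16_10_weighted c' (eq16_5P_holds c') h10w

/-- **(16.12) ⇐ (16.10) alone, uniform variant** (error `C·𝓛⁻¹²⁰` on the support of `b₁`, coprimality of
`l` only): via `eq16_12_of_eq16_5P_of_eq16_10R_on_support`. [cite: Zhang2022LandauSiegel, §16 (16.12) p.92] -/
theorem eq16_12_of_eq16_10R
    (h10 : ∃ C : ℝ, ForAllLarge fun D _ χ => AssumptionA D χ →
      ∀ d l : ℕ, 1 ≤ d → 1 ≤ l →
        ((d * l : ℕ) : ℝ) < 2 * bigT D ^ 2 * (bigP D ^ (1 / 2 : ℝ) * max (Skeleton.P2 D) (P3 D)) →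
        Nat.Coprime l D →
        ‖calD2 c' χ d l - lam2 c' χ d 1 * ∑ j ∈ ({1, 2} : Finset ℕ),
            calR2 c' χ j * (d : ℂ) ^ betaJ c' D j * calM2 c' χ d l (1 - betaJ c' D j)‖ ≤
          C * (ell D ^ 120)⁻¹) :
    Eq16_12 c' :=
  eq16_12_of_eq16_5P_of_eq16_10R_on_support c' (eq16_5P_holds c') h10

/-- **(16.12) ⇐ (16.10) with its printed rate `O(ε₁)`** (on the support of `b₁`, coprimality of `l` only):
via `eq16_12_of_eq16_5P_of_eq16_10_on_support`. [cite: Zhang2022LandauSiegel, §16 (16.12) p.92] -/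
theorem eq16_12_of_eq16_10_eps
    (h10 : ∃ c : ℝ, 0 < c ∧ ∃ C : ℝ, ForAllLarge fun D _ χ => AssumptionA D χ →
      ∀ d l : ℕ, 1 ≤ d → 1 ≤ l →
        ((d * l : ℕ) : ℝ) < 2 * bigT D ^ 2 * (bigP D ^ (1 / 2 : ℝ) * max (Skeleton.P2 D) (P3 D)) →
        Nat.Coprime l D →
        ‖calD2 c' χ d l - lam2 c' χ d 1 * ∑ j ∈ ({1, 2} : Finset ℕ),
            calR2 c' χ j * (d : ℂ) ^ betaJ c' D j * calM2 c' χ d l (1 - betaJ c' D j)‖ ≤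
          C * Real.exp (-c * ell D ^ (1 / 10 : ℝ))) :
    Eq16_12 c' :=
  eq16_12_of_eq16_5P_of_eq16_10_on_support c' (eq16_5P_holds c') h10

end Literature.NumberTheory.LFunctions.Zhang2022.Typed.Section16A
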